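import Summits.QuantumFields.YangMills.Theses.FradkinShenkerFlow
import Summits.QuantumFields.YangMills.Theorems.FradkinShenkerFlowSusceptibilityToPoincareTwoBlockFactorization
import Literature.MathematicalPhysics.QuantumLattice.TorusWilsonMarkov

/-!
# Stub `stub_pinnedClusterBound` of the line `planted-link-pinning` (crux `SusceptibilityToPoincare`)

Route `FradkinShenkerFlow` of `YangMills`, crux item `stmt-QuantumFields-9441`
(`Summit.QuantumFields.YangMills.Theses.FradkinShenkerFlow.SusceptibilityToPoincare`, FS ⇒ UP).
This file proves stub S3d `stub_pinnedClusterBound` of the line `planted-link-pinning`: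
**the residual variance given FIXED pinned links `Λ`, through plaquette-closed blocks of free
links.** `μ = wilsonMeasure r.ρ β` on `(ℤ/(2S+1))⁴`, `P_D := μ[· | cylinderEvents D]`; `c` labels
the links and is constant on FREE links (links off `Λ`) sharing a plaquette, so every block
`K_v = {ℓ ∉ Λ | c ℓ = v}` is PLAQUETTE-CLOSED (a plaquette meeting `K_v` lies in `K_v ∪ Λ`).
HYPOTHESIS (= stub S3c): `‖F − P_{Dᶜ} F‖₂² ≤ A B^{#D} Σ_{ℓ ∈ D} hb_ℓ(F)` for all finite link sets
`D`. CONCLUSION: `‖F − P_Λ F‖₂² ≤ Σ_{ℓ ∉ Λ} A B^{#block(ℓ)} hb_ℓ(F)`.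

## Proof

* (a) MARKOV PROPERTY OF A PLAQUETTE-CLOSED BLOCK (`PinnedCluster.condExp_condExp_markov`): for a
  finite link set `K` and `T ⊆ Kᶜ` such that every plaquette meeting `K` lies in `K ∪ T`,
  `P_{K ∪ T} P_{Kᶜ} f = P_T P_{Kᶜ} f` a.e.  The torus Wilson state is a DLR state of the plaquette
  specification (`exists_plaquettePotential`, `isGibbsMeasure_wilsonMeasure`) whose kernel `γ_K`
  is a version of `P_{Kᶜ}` reading only links of plaquettes touching `K`
  (`stronglyMeasurable_and_ae_eq_condExp_integral_gibbsSpecOfPotential`): `P_{Kᶜ} 1_s` has an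
  `𝓕_T`-measurable version for `s ∈ 𝓕_{K ∪ T}`, and the operator identity follows by DUALITY
  (`PinnedCluster.condExp_ae_eq_condExp_of_indicator`, pull-out property thrice and
  `ae_eq_condExp_of_forall_setIntegral_eq`) applied to a bounded version of `P_{Kᶜ} f`.
* (b) BLOCK EFRON–STEIN (`PinnedCluster.integral_sub_condExp_sq_le_sum`, any finite measure):
  along `𝓖_0 ≤ 𝓖_1 ≤ ⋯`, `𝓖_j ≤ m_j`, with `P_{𝓖_{j+1}} P_{m_j} F = P_{𝓖_j} P_{m_j} F`:
  `‖F − P_{𝓖_0} F‖² ≤ ‖F − P_{𝓖_n} F‖² + Σ_{j<n} ‖F − P_{m_j} F‖²` — Pythagoras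
  (`PinnedCluster.integral_sub_condExp_sq_eq_add`, from `TwoBlock.integral_sub_condExp_sq`) and
  `P_{𝓖_{j+1}} F − P_{𝓖_j} F = P_{𝓖_{j+1}} (F − P_{m_j} F)`, an `L²` contraction
  (`PinnedCluster.integral_condExp_sub_condExp_sq_le`).
* (c) ASSEMBLY: blocks `K_j = {ℓ ∉ Λ | c ℓ = j}`, `j < N := 1 + max label`,
  `𝓖_j = 𝓕_{Λ ∪ {ℓ ∉ Λ | c ℓ < j}}` (`𝓖_0 = 𝓕_Λ`, `𝓖_N = 𝓕_{univ}`), `m_j = 𝓕_{K_jᶜ}`; the hypothesis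
  with `D = K_j`, and `Σ_j Σ_{ℓ ∈ K_j} = Σ_{ℓ ∉ Λ}`.  References: F. Martinelli, LNM 1717 (1999), §3;
  H.-O. Georgii, *Gibbs Measures and Phase Transitions* (2011), Rem. 1.24 with (2.11).
-/

noncomputable section

open MeasureTheory ProbabilityTheory Filter
open Literature.MathematicalPhysics.QuantumFieldTheory
open Literature.MathematicalPhysics.QuantumLattice (integral_sq_congr_ae ae_abs_sub_le_add
  integrable_of_ae_bdd_abs integral_condExp_sq_le_of_ae_bdd exists_stronglyMeasurable_truncation
  dependsOn_of_measurable_cylinderEvents_real exists_plaquettePotential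
  isGibbsMeasure_wilsonMeasure stronglyMeasurable_and_ae_eq_condExp_integral_gibbsSpecOfPotential)
open Literature.Probability.LatticeModels (gibbsSpecOfPotential IsGibbsMeasure)

namespace Summit.QuantumFields.YangMills.Theorems.SusceptibilityToPoincare

namespace PinnedCluster

/-! ### Abstract `L²` facts on a finite measure space -/

section Abstract

variable {Ω : Type*} {m0 : MeasurableSpace Ω} {μ : Measure Ω} [IsFiniteMeasure μ]

/-- **Pythagoras along nested σ-algebras**: for `mA ≤ mB` and `F ∈ L²`,
`‖F − P_A F‖₂² = ‖F − P_B F‖₂² + ‖P_B F − P_A F‖₂²` (`P_A P_B = P_A` and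
`‖h − P h‖² = ‖h‖² − ‖P h‖²` for an orthogonal projection `P`). [folklore] -/
theorem integral_sub_condExp_sq_eq_add {mA mB : MeasurableSpace Ω} (hAB : mA ≤ mB)
    (hB : mB ≤ m0) {F : Ω → ℝ} (hF : MemLp F 2 μ) :
    ∫ ω, (F ω - (μ[F|mA]) ω) ^ 2 ∂μ =
      ∫ ω, (F ω - (μ[F|mB]) ω) ^ 2 ∂μ + ∫ ω, ((μ[F|mB]) ω - (μ[F|mA]) ω) ^ 2 ∂μ := by
  have hA : mA ≤ m0 := hAB.trans hB
  have hFB : MemLp (μ[F|mB]) 2 μ := hF.condExp one_le_two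
  have htower : μ[μ[F|mB]|mA] =ᵐ[μ] μ[F|mA] := condExp_condExp_of_le hAB hB
  have e1 : (fun ω => (μ[F|mB]) ω - (μ[μ[F|mB]|mA]) ω) =ᵐ[μ]
      fun ω => (μ[F|mB]) ω - (μ[F|mA]) ω := by
    filter_upwards [htower] with ω hω
    rw [hω]
  have h3 : ∫ ω, ((μ[F|mB]) ω - (μ[F|mA]) ω) ^ 2 ∂μ =
      ∫ ω, (μ[F|mB]) ω ^ 2 ∂μ - ∫ ω, (μ[F|mA]) ω ^ 2 ∂μ := by
    rw [← integral_sq_congr_ae e1, TwoBlock.integral_sub_condExp_sq hA hFB,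
      integral_sq_congr_ae htower]
  rw [TwoBlock.integral_sub_condExp_sq hA hF, TwoBlock.integral_sub_condExp_sq hB hF, h3]
  ring

/-- **A Markov martingale increment is a conditioned residual**: if `mA ≤ m'` and
`P_B P' F = P_A P' F` a.e. (Markov), then `P_B F − P_A F = P_B (F − P' F)` a.e. (tower property),
hence `‖P_B F − P_A F‖₂² ≤ ‖F − P' F‖₂²` (`P_B` contracts `L²`). [folklore] -/
theorem integral_condExp_sub_condExp_sq_le {mA mB m' : MeasurableSpace Ω}
    (hAm : mA ≤ m') (hm' : m' ≤ m0) {F : Ω → ℝ} (hF : AEStronglyMeasurable[m0] F μ)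
    {M : ℝ} (hb : ∀ᵐ ω ∂μ, |F ω| ≤ M)
    (hMarkov : μ[μ[F|m']|mB] =ᵐ[μ] μ[μ[F|m']|mA]) :
    ∫ ω, ((μ[F|mB]) ω - (μ[F|mA]) ω) ^ 2 ∂μ ≤ ∫ ω, (F ω - (μ[F|m']) ω) ^ 2 ∂μ := by
  have hFi : Integrable F μ := integrable_of_ae_bdd_abs hF hb
  have h1 : μ[F|mA] =ᵐ[μ] μ[μ[F|m']|mB] :=
    (condExp_condExp_of_le hAm hm').symm.trans hMarkov.symm
  have h2 : μ[fun ω => F ω - (μ[F|m']) ω|mB] =ᵐ[μ] fun ω => (μ[F|mB]) ω - (μ[F|mA]) ω := by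
    refine (condExp_sub hFi (integrable_condExp (m := m') (μ := μ) (f := F)) mB).trans ?_
    filter_upwards [h1] with ω hω
    simp only [Pi.sub_apply, hω]
  rw [← integral_sq_congr_ae h2]
  exact integral_condExp_sq_le_of_ae_bdd (hF.sub integrable_condExp.aestronglyMeasurable)
    (ae_abs_sub_le_add hb (ae_bdd_abs_condExp_of_ae_bdd_abs hb))

/-- **Block Efron–Stein along a filtration with Markov blocks.** For sub-σ-algebras
`𝓖 0 ≤ 𝓖 1 ≤ ⋯`, `𝓖 j ≤ m j`, with `P_{𝓖 (j+1)} P_{m j} F = P_{𝓖 j} P_{m j} F` a.e. (`F` a.e.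
bounded): `‖F − P_{𝓖 0} F‖₂² ≤ ‖F − P_{𝓖 n} F‖₂² + Σ_{j<n} ‖F − P_{m j} F‖₂²` (orthogonal martingale
increments, each dominated in `L²` by the residual `F − P_{m j} F`). [folklore] -/
theorem integral_sub_condExp_sq_le_sum (𝓖 m : ℕ → MeasurableSpace Ω)
    (h𝓖 : ∀ j, 𝓖 j ≤ m0) (hm : ∀ j, m j ≤ m0) (hmono : ∀ j, 𝓖 j ≤ 𝓖 (j + 1))
    (hle : ∀ j, 𝓖 j ≤ m j) {F : Ω → ℝ} (hF : AEStronglyMeasurable[m0] F μ) {M : ℝ}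
    (hb : ∀ᵐ ω ∂μ, |F ω| ≤ M)
    (hMarkov : ∀ j, μ[μ[F|m j]|𝓖 (j + 1)] =ᵐ[μ] μ[μ[F|m j]|𝓖 j]) (n : ℕ) :
    ∫ ω, (F ω - (μ[F|𝓖 0]) ω) ^ 2 ∂μ ≤
      ∫ ω, (F ω - (μ[F|𝓖 n]) ω) ^ 2 ∂μ +
        ∑ j ∈ Finset.range n, ∫ ω, (F ω - (μ[F|m j]) ω) ^ 2 ∂μ := by
  have hF2 : MemLp F 2 μ := MemLp.of_bound hF M (hb.mono fun ω h => by rwa [Real.norm_eq_abs])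
  induction n with
  | zero => simp
  | succ n ih =>
    have hP := integral_sub_condExp_sq_eq_add (μ := μ) (hmono n) (h𝓖 (n + 1)) hF2
    have hQ := integral_condExp_sub_condExp_sq_le (μ := μ) (mB := 𝓖 (n + 1)) (hle n) (hm n) hF hb
      (hMarkov n)
    rw [Finset.sum_range_succ]
    linarith

/-- **Duality for conditional independence.** Let `mT ≤ mKT`, `mT ≤ mKc` be sub-σ-algebras such
that `P_{Kc} 1_s` has an `mT`-measurable version for every `mKT`-measurable set `s`. Then
`P_{KT} g = P_T g` a.e. for every bounded `mKc`-measurable `g`: for `s ∈ mKT`,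
`∫_s P_T g = ∫ P_T g · P_{Kc} 1_s = ∫ P_T (g · P_{Kc} 1_s) = ∫ g · P_{Kc} 1_s = ∫_s g` (pull-out
property), and `ae_eq_condExp_of_forall_setIntegral_eq`. [folklore] -/
theorem condExp_ae_eq_condExp_of_indicator {mT mKT mKc : MeasurableSpace Ω} (hT : mT ≤ mKT)
    (hKT : mKT ≤ m0) (hTc : mT ≤ mKc) (hKc : mKc ≤ m0)
    (hind : ∀ s, MeasurableSet[mKT] s →
      AEStronglyMeasurable[mT] (μ[s.indicator fun _ => (1 : ℝ)|mKc]) μ)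
    {g : Ω → ℝ} (hgm : StronglyMeasurable[mKc] g) {C : ℝ} (hgb : ∀ ω, |g ω| ≤ C) :
    μ[g|mKT] =ᵐ[μ] μ[g|mT] := by
  have hgi : Integrable g μ :=
    integrable_of_ae_bdd_abs (hgm.mono hKc).aestronglyMeasurable (ae_of_all _ hgb)
  refine (ae_eq_condExp_of_forall_setIntegral_eq hKT hgi
    (fun s _ _ => integrable_condExp.integrableOn) (fun s hs _ => ?_)
    (stronglyMeasurable_condExp.mono hT).aestronglyMeasurable).symm
  have hs0 : MeasurableSet[m0] s := hKT s hs
  set χ : Ω → ℝ := s.indicator fun _ => (1 : ℝ) with hχ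
  have hχi : Integrable χ μ := (integrable_const (1 : ℝ)).indicator hs0
  have hχb' : ∀ᵐ ω ∂μ, |χ ω| ≤ 1 := ae_of_all _ fun ω => by
    by_cases hω : ω ∈ s
    · simp only [hχ, Set.indicator_of_mem hω, abs_one, le_refl]
    · simp only [hχ, Set.indicator_of_notMem hω, abs_zero, zero_le_one]
  have hχb : ∀ᵐ ω ∂μ, ‖χ ω‖ ≤ 1 := hχb'.mono fun ω hω => by rwa [Real.norm_eq_abs]
  have hPb : ∀ᵐ ω ∂μ, ‖(μ[χ|mKc]) ω‖ ≤ 1 :=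
    (ae_bdd_abs_condExp_of_ae_bdd_abs hχb').mono fun ω hω => by rwa [Real.norm_eq_abs]
  have h1 : Integrable (μ[g|mT] * χ) μ :=
    integrable_condExp.mul_bdd hχi.aestronglyMeasurable hχb
  have h2 : Integrable (g * μ[χ|mKc]) μ :=
    hgi.mul_bdd integrable_condExp.aestronglyMeasurable hPb
  have h3 : Integrable (g * χ) μ := hgi.mul_bdd hχi.aestronglyMeasurable hχb
  have hmul : ∀ u : Ω → ℝ, s.indicator u = u * χ := fun u => by
    funext ω
    by_cases hω : ω ∈ s
    · simp only [Pi.mul_apply, hχ, Set.indicator_of_mem hω, mul_one]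
    · simp only [Pi.mul_apply, hχ, Set.indicator_of_notMem hω, mul_zero]
  calc ∫ ω in s, (μ[g|mT]) ω ∂μ
      = ∫ ω, (μ[g|mT] * χ) ω ∂μ := by rw [← integral_indicator hs0, hmul]
    _ = ∫ ω, (μ[μ[g|mT] * χ|mKc]) ω ∂μ := (integral_condExp hKc).symm
    _ = ∫ ω, (μ[g|mT] * μ[χ|mKc]) ω ∂μ :=
        integral_congr_ae (condExp_mul_of_stronglyMeasurable_left
          (stronglyMeasurable_condExp.mono hTc) h1 hχi)
    _ = ∫ ω, (μ[g * μ[χ|mKc]|mT]) ω ∂μ :=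
        (integral_congr_ae (condExp_mul_of_aestronglyMeasurable_right (hind s hs) h2 hgi)).symm
    _ = ∫ ω, (g * μ[χ|mKc]) ω ∂μ := integral_condExp (hT.trans hKT)
    _ = ∫ ω, (μ[g * χ|mKc]) ω ∂μ :=
        (integral_congr_ae (condExp_mul_of_stronglyMeasurable_left hgm h3 hχi)).symm
    _ = ∫ ω, (g * χ) ω ∂μ := integral_condExp hKc
    _ = ∫ ω in s, g ω ∂μ := by rw [← integral_indicator hs0, hmul]

end Abstract

/-! ### The Markov property of the torus Wilson measure across a plaquette-closed block -/

section Markov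

variable {G : Type} [Group G] [TopologicalSpace G] [IsTopologicalGroup G] [CompactSpace G]
  [MeasurableSpace G] [BorelSpace G]

/-- **Markov property of the torus Wilson measure across a plaquette-closed block, operator
form** (Georgii 2011, Rem. 1.24 with (2.11)). Let `μ = wilsonMeasure r.ρ β`, `K` a finite link
set, `T ⊆ Kᶜ` a link set such that every plaquette meeting `K` has all its links in `K ∪ T`, and
`f` a.e. bounded. Then `P_{K ∪ T} P_{Kᶜ} f = P_T P_{Kᶜ} f` a.e. (`P_E := μ[· | cylinderEvents E]`):
`μ[1_s | 𝓕_{Kᶜ}]` has the `𝓕_T`-measurable version `γ_K 1_s` (DLR kernel of the plaquette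
specification: `exists_plaquettePotential`, `isGibbsMeasure_wilsonMeasure`,
`stronglyMeasurable_and_ae_eq_condExp_integral_gibbsSpecOfPotential`) for `s ∈ 𝓕_{K ∪ T}`, and
duality (`condExp_ae_eq_condExp_of_indicator`) applies to a bounded version of `P_{Kᶜ} f`. [folklore] -/
theorem condExp_condExp_markov (r : LatticeRep G) (β : ℝ) (S : ℕ)
    (μ : Measure (GaugeConfig 4 (2 * S + 1) G))
    (hμ : μ = (wilsonMeasure r.ρ β : Measure (GaugeConfig 4 (2 * S + 1) G)))
    (K : Finset (Edge 4 (2 * S + 1))) (T : Set (Edge 4 (2 * S + 1)))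
    (hKT : T ⊆ (↑K : Set (Edge 4 (2 * S + 1)))ᶜ)
    (hcl : ∀ (y : Site 4 (2 * S + 1)) (i j : Fin 4), i < j →
      (({(y, i), (y.shift i, j), (y.shift j, i), (y, j)} : Finset (Edge 4 (2 * S + 1))) ∩ K).Nonempty →
      (↑({(y, i), (y.shift i, j), (y.shift j, i), (y, j)} : Finset (Edge 4 (2 * S + 1))) :
        Set (Edge 4 (2 * S + 1))) ⊆ ↑K ∪ T)
    {f : GaugeConfig 4 (2 * S + 1) G → ℝ} {M : ℝ} (hb : ∀ᵐ U ∂μ, |f U| ≤ M) :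
    μ[μ[f | cylinderEvents (↑K : Set (Edge 4 (2 * S + 1)))ᶜ] | cylinderEvents (↑K ∪ T)] =ᵐ[μ]
      μ[μ[f | cylinderEvents (↑K : Set (Edge 4 (2 * S + 1)))ᶜ] | cylinderEvents T] := by
  haveI : SecondCountableTopology G :=
    (r.continuous.isClosedEmbedding r.injective).isEmbedding.secondCountableTopology
  haveI : T2Space G := (r.continuous.isClosedEmbedding r.injective).isEmbedding.t2Space
  haveI : IsProbabilityMeasure μ :=
    hμ ▸ isProbabilityMeasure_wilsonMeasure (d := 4) (L := 2 * S + 1) r.ρ r.continuous β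
  obtain ⟨Φ, supp, hΦ, hΦb, hsupp, hH, hstruct⟩ :=
    exists_plaquettePotential (d := 4) (L := 2 * S + 1) r.ρ r.continuous
  have hGibbs : IsGibbsMeasure (gibbsSpecOfPotential (haarProbability G) Φ supp β) μ :=
    hμ ▸ isGibbsMeasure_wilsonMeasure r.ρ r.continuous hΦ hΦb hsupp hH β
  have hT : ∀ A ∈ supp K, (A ∩ K).Nonempty → (↑A : Set (Edge 4 (2 * S + 1))) ⊆ ↑K ∪ T := by
    intro A hA hne
    obtain ⟨y, i, j, hij, rfl⟩ := hstruct K A hA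
    exact hcl y i j hij hne
  -- `P_{Kᶜ} 1_s` has the `𝓕_T`-measurable version `γ_K 1_s` for `s ∈ 𝓕_{K ∪ T}`
  have hind : ∀ s, MeasurableSet[cylinderEvents (↑K ∪ T)] s →
      AEStronglyMeasurable[cylinderEvents T]
        (μ[s.indicator fun _ => (1 : ℝ) | cylinderEvents (↑K : Set (Edge 4 (2 * S + 1)))ᶜ]) μ := by
    intro s hs
    have hχm : Measurable (s.indicator fun _ => (1 : ℝ)) :=
      measurable_const.indicator (cylinderEvents_le_pi s hs)
    have hχm' : Measurable[cylinderEvents (↑K ∪ T)] (s.indicator fun _ => (1 : ℝ)) :=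
      measurable_const.indicator hs
    have hχb : ∀ U, |s.indicator (fun _ => (1 : ℝ)) U| ≤ 1 := fun U => by
      by_cases hU : U ∈ s
      · simp only [Set.indicator_of_mem hU, abs_one, le_refl]
      · simp only [Set.indicator_of_notMem hU, abs_zero, zero_le_one]
    obtain ⟨hWm, hWae⟩ := stronglyMeasurable_and_ae_eq_condExp_integral_gibbsSpecOfPotential
      (haarProbability G) hΦ hΦb hsupp β hGibbs K hT hχm hχb
      (dependsOn_of_measurable_cylinderEvents_real hχm')
    exact ⟨_, hWm, hWae.symm⟩
  -- a bounded `𝓕_{Kᶜ}`-measurable version of `P_{Kᶜ} f`, and duality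
  have hhm : StronglyMeasurable[cylinderEvents (↑K : Set (Edge 4 (2 * S + 1)))ᶜ]
      (μ[f | cylinderEvents (↑K : Set (Edge 4 (2 * S + 1)))ᶜ]) := stronglyMeasurable_condExp
  obtain ⟨g, hgm, hgb, hg⟩ := exists_stronglyMeasurable_truncation hhm M
  have hgae : g =ᵐ[μ] μ[f | cylinderEvents (↑K : Set (Edge 4 (2 * S + 1)))ᶜ] :=
    (ae_bdd_abs_condExp_of_ae_bdd_abs hb).mono fun U hU => hg U hU
  have key := condExp_ae_eq_condExp_of_indicator (μ := μ)
    (cylinderEvents_mono Set.subset_union_right) cylinderEvents_le_pi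
    (cylinderEvents_mono hKT) cylinderEvents_le_pi hind hgm hgb
  exact (condExp_congr_ae hgae.symm).trans (key.trans (condExp_congr_ae hgae))

end Markov

end PinnedCluster

/-! ### The registered stub -/

/-- `stub_pinnedClusterBound` — **S3d · residual variance given FIXED pins, through
plaquette-closed blocks of free links.** Let `μ = wilsonMeasure r.ρ β` on `(ℤ/(2S+1))⁴`,
`P_D := μ[· | cylinderEvents D]`. HYPOTHESES: constants `A ≥ 0`, `B ≥ 1` with the link-set bound
`‖F − P_{Dᶜ} F‖₂² ≤ A B^{#D} Σ_{ℓ ∈ D} hb_ℓ(F)` for every finite link set `D` (`hb_ℓ` the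
single-link heat-bath Dirichlet contribution); a pinned set `Λ`; a labelling `c` of the links,
constant on FREE links sharing a plaquette. CONCLUSION:
`‖F − P_Λ F‖₂² ≤ Σ_{ℓ ∉ Λ} A B^{#block(ℓ)} hb_ℓ(F)`, `block(ℓ) = {ℓ' ∉ Λ | c ℓ' = c ℓ}`.
Proof: the blocks `K_j = {ℓ ∉ Λ | c ℓ = j}` (`j < N = 1 + max label`) are plaquette-closed, so
`P_{𝓖_{j+1}} P_{K_jᶜ} = P_{𝓖_j} P_{K_jᶜ}` along `𝓖_j = 𝓕_{Λ ∪ {ℓ ∉ Λ | c ℓ < j}}`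
(`PinnedCluster.condExp_condExp_markov`); block Efron–Stein
(`PinnedCluster.integral_sub_condExp_sq_le_sum`, `𝓖_N = 𝓕_{univ}`) gives
`‖F − P_Λ F‖² ≤ Σ_j ‖F − P_{K_jᶜ} F‖²`; the hypothesis bounds each block term, and
`Σ_j Σ_{ℓ ∈ K_j} = Σ_{ℓ ∉ Λ}`, `#K_j = #block(ℓ)` for `ℓ ∈ K_j`. Martinelli 1999 §3. [folklore] -/
theorem stub_pinnedClusterBound :
    ∀ (G : Type) [Group G] [TopologicalSpace G] [IsTopologicalGroup G] [CompactSpace G]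
      [MeasurableSpace G] [BorelSpace G] (r : LatticeRep G) (β : ℝ) (A B : ℝ), 0 ≤ A → 1 ≤ B →
      (∀ (S : ℕ) (μW : Measure (GaugeConfig 4 (2 * S + 1) G)),
        μW = (wilsonMeasure r.ρ β : Measure (GaugeConfig 4 (2 * S + 1) G)) →
        ∀ (D : Finset (Edge 4 (2 * S + 1))) (F : GaugeConfig 4 (2 * S + 1) G → ℝ),
        Measurable F → (∃ M : ℝ, ∀ U, |F U| ≤ M) →
        ∫ U, (F U - (μW[F | cylinderEvents ((↑D : Set (Edge 4 (2 * S + 1)))ᶜ)]) U) ^ 2 ∂μW ≤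
          A * B ^ D.card * ∑ ℓ ∈ D, ∫ U, ∫ g, (F U - F (Function.update U ℓ g)) ^ 2
            ∂((haarProbability G).tilted (fun g' => -β * wilsonAction r.ρ (Function.update U ℓ g'))) ∂μW) →
      ∀ (S : ℕ) (μW : Measure (GaugeConfig 4 (2 * S + 1) G)),
      μW = (wilsonMeasure r.ρ β : Measure (GaugeConfig 4 (2 * S + 1) G)) →
      ∀ (Λ : Finset (Edge 4 (2 * S + 1))) (c : Edge 4 (2 * S + 1) → ℕ),
      (∀ (y : Site 4 (2 * S + 1)) (i j : Fin 4), i < j →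
        ∀ e ∈ ({(y, i), (y.shift i, j), (y.shift j, i), (y, j)} : Finset (Edge 4 (2 * S + 1))),
        ∀ e' ∈ ({(y, i), (y.shift i, j), (y.shift j, i), (y, j)} : Finset (Edge 4 (2 * S + 1))),
        e ∉ Λ → e' ∉ Λ → c e = c e') →
      ∀ (F : GaugeConfig 4 (2 * S + 1) G → ℝ), Measurable F → (∃ M : ℝ, ∀ U, |F U| ≤ M) →
      ∫ U, (F U - (μW[F | cylinderEvents (↑Λ : Set (Edge 4 (2 * S + 1)))]) U) ^ 2 ∂μW ≤
        ∑ ℓ ∈ Finset.univ.filter (fun ℓ : Edge 4 (2 * S + 1) => ℓ ∉ Λ),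
          A * B ^ (Finset.univ.filter (fun ℓ' : Edge 4 (2 * S + 1) => ℓ' ∉ Λ ∧ c ℓ' = c ℓ)).card *
            ∫ U, ∫ g, (F U - F (Function.update U ℓ g)) ^ 2
              ∂((haarProbability G).tilted (fun g' => -β * wilsonAction r.ρ (Function.update U ℓ g'))) ∂μW := by
  intro G _ _ _ _ _ _ r β A B _ _ hLink S μW hμ Λ c hc F hF hFb
  obtain ⟨M, hM⟩ := hFb
  haveI : IsProbabilityMeasure μW :=
    hμ ▸ isProbabilityMeasure_wilsonMeasure (d := 4) (L := 2 * S + 1) r.ρ r.continuous β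
  have hFi : Integrable F μW := integrable_of_ae_bdd_abs hF.aestronglyMeasurable (ae_of_all _ hM)
  -- free links, blocks `K j`, filtration sets `T j`, number of levels `N`
  set free : Finset (Edge 4 (2 * S + 1)) := Finset.univ.filter (fun ℓ : Edge 4 (2 * S + 1) => ℓ ∉ Λ)
    with hfree
  set K : ℕ → Finset (Edge 4 (2 * S + 1)) := fun j => free.filter (fun ℓ => c ℓ = j) with hK
  set T : ℕ → Set (Edge 4 (2 * S + 1)) := fun j =>
    (↑Λ : Set (Edge 4 (2 * S + 1))) ∪ {ℓ | ℓ ∉ Λ ∧ c ℓ < j} with hT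
  set N : ℕ := free.sup c + 1 with hN
  have hmemfree : ∀ ℓ, ℓ ∈ free ↔ ℓ ∉ Λ := fun ℓ => by
    simp only [hfree, Finset.mem_filter, Finset.mem_univ, true_and]
  have hmemK : ∀ j ℓ, ℓ ∈ K j ↔ ℓ ∉ Λ ∧ c ℓ = j := fun j ℓ => by
    simp only [hK, Finset.mem_filter, hmemfree]
  have hmemT : ∀ j ℓ, ℓ ∈ T j ↔ ℓ ∈ Λ ∨ (ℓ ∉ Λ ∧ c ℓ < j) := fun j ℓ => by
    simp only [hT, Set.mem_union, Finset.mem_coe, Set.mem_setOf_eq]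
  have hcN : ∀ ℓ, ℓ ∉ Λ → c ℓ < N := fun ℓ hℓ =>
    Nat.lt_succ_of_le (Finset.le_sup (f := c) ((hmemfree ℓ).2 hℓ))
  have hT0 : T 0 = (↑Λ : Set (Edge 4 (2 * S + 1))) := by
    ext ℓ
    simp only [hmemT, Finset.mem_coe, Nat.not_lt_zero, and_false, or_false]
  have hTN : T N = Set.univ := Set.eq_univ_iff_forall.2 fun ℓ =>
    (hmemT N ℓ).2 ((em (ℓ ∈ Λ)).imp_right fun hℓ => ⟨hℓ, hcN ℓ hℓ⟩)
  have hTsucc : ∀ j, T (j + 1) = ↑(K j) ∪ T j := by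
    intro j
    ext ℓ
    simp only [hmemT, hmemK, Set.mem_union, Finset.mem_coe]
    by_cases h : ℓ ∈ Λ
    · simp [h]
    · simp only [h, not_false_eq_true, true_and, false_or]
      omega
  have hTmono : ∀ j, T j ⊆ T (j + 1) := fun j => by
    rw [hTsucc j]
    exact Set.subset_union_right
  have hTK : ∀ j, T j ⊆ (↑(K j) : Set (Edge 4 (2 * S + 1)))ᶜ := by
    intro j ℓ hℓ
    rw [Set.mem_compl_iff, Finset.mem_coe, hmemK]
    intro hℓK
    rcases (hmemT j ℓ).1 hℓ with h | ⟨-, h⟩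
    · exact hℓK.1 h
    · exact absurd hℓK.2 h.ne
  -- the blocks are plaquette-closed
  have hclosed : ∀ (j : ℕ) (y : Site 4 (2 * S + 1)) (i i' : Fin 4), i < i' →
      (({(y, i), (y.shift i, i'), (y.shift i', i), (y, i')} : Finset (Edge 4 (2 * S + 1))) ∩
        K j).Nonempty →
      (↑({(y, i), (y.shift i, i'), (y.shift i', i), (y, i')} : Finset (Edge 4 (2 * S + 1))) :
        Set (Edge 4 (2 * S + 1))) ⊆ ↑(K j) ∪ T j := by
    intro j y i i' hii' ⟨e, he⟩ e' he'
    rw [Finset.mem_inter, hmemK] at he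
    rw [Finset.mem_coe] at he'
    simp only [Set.mem_union, Finset.mem_coe, hmemK, hmemT]
    by_cases he'Λ : e' ∈ Λ
    · exact Or.inr (Or.inl he'Λ)
    · have hce : c e = c e' := hc y i i' hii' e he.1 e' he' he.2.1 he'Λ
      exact Or.inl ⟨he'Λ, hce ▸ he.2.2⟩
  -- (a) the Markov identities along the block filtration
  have hMarkov : ∀ j, μW[μW[F | cylinderEvents (↑(K j) : Set (Edge 4 (2 * S + 1)))ᶜ] |
      cylinderEvents (T (j + 1))] =ᵐ[μW]
      μW[μW[F | cylinderEvents (↑(K j) : Set (Edge 4 (2 * S + 1)))ᶜ] | cylinderEvents (T j)] := by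
    intro j
    rw [hTsucc j]
    exact PinnedCluster.condExp_condExp_markov r β S μW hμ (K j) (T j) (hTK j) (hclosed j)
      (ae_of_all _ hM)
  -- (b) block Efron–Stein
  have hchain : ∫ U, (F U - (μW[F | cylinderEvents (T 0)]) U) ^ 2 ∂μW ≤
      ∫ U, (F U - (μW[F | cylinderEvents (T N)]) U) ^ 2 ∂μW +
        ∑ j ∈ Finset.range N,
          ∫ U, (F U - (μW[F | cylinderEvents (↑(K j) : Set (Edge 4 (2 * S + 1)))ᶜ]) U) ^ 2 ∂μW :=
    PinnedCluster.integral_sub_condExp_sq_le_sum (μ := μW) (fun j => cylinderEvents (T j))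
      (fun j => cylinderEvents (↑(K j) : Set (Edge 4 (2 * S + 1)))ᶜ)
      (fun _ => cylinderEvents_le_pi) (fun _ => cylinderEvents_le_pi)
      (fun j => cylinderEvents_mono (hTmono j)) (fun j => cylinderEvents_mono (hTK j))
      hF.aestronglyMeasurable (ae_of_all _ hM) hMarkov N
  have hlast : ∫ U, (F U - (μW[F | cylinderEvents (T N)]) U) ^ 2 ∂μW = 0 := by
    have hpi : (cylinderEvents (T N) : MeasurableSpace (GaugeConfig 4 (2 * S + 1) G)) =
        MeasurableSpace.pi := by
      rw [hTN, cylinderEvents_univ]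
    rw [hpi, condExp_of_stronglyMeasurable le_rfl hF.stronglyMeasurable hFi]
    simp
  rw [hT0, hlast, zero_add] at hchain
  -- (c) the hypothesis on each block, and regrouping of the double sum
  have hKblock : ∀ j, ∀ ℓ ∈ K j,
      K j = Finset.univ.filter (fun ℓ' : Edge 4 (2 * S + 1) => ℓ' ∉ Λ ∧ c ℓ' = c ℓ) := by
    intro j ℓ hℓ
    obtain ⟨-, hcℓ⟩ := (hmemK j ℓ).1 hℓ
    ext ℓ'
    rw [hmemK, Finset.mem_filter, hcℓ]
    simp only [Finset.mem_univ, true_and]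
  have hstep : ∀ j,
      ∫ U, (F U - (μW[F | cylinderEvents (↑(K j) : Set (Edge 4 (2 * S + 1)))ᶜ]) U) ^ 2 ∂μW ≤
        ∑ ℓ ∈ K j, A * B ^ (Finset.univ.filter
            (fun ℓ' : Edge 4 (2 * S + 1) => ℓ' ∉ Λ ∧ c ℓ' = c ℓ)).card *
          ∫ U, ∫ g, (F U - F (Function.update U ℓ g)) ^ 2
            ∂((haarProbability G).tilted
              (fun g' => -β * wilsonAction r.ρ (Function.update U ℓ g'))) ∂μW := by
    intro j
    refine (hLink S μW hμ (K j) F hF ⟨M, hM⟩).trans (le_of_eq ?_)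
    rw [Finset.mul_sum]
    refine Finset.sum_congr rfl fun ℓ hℓ => ?_
    rw [← hKblock j ℓ hℓ]
  refine hchain.trans ((Finset.sum_le_sum fun j _ => hstep j).trans (le_of_eq ?_))
  exact Finset.sum_fiberwise_of_maps_to
    (fun ℓ hℓ => Finset.mem_range.2 (hcN ℓ ((hmemfree ℓ).1 hℓ))) _

end Summit.QuantumFields.YangMills.Theorems.SusceptibilityToPoincare

end
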